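import Mathlib
import Literature.NumberTheory.Transcendental.KZHomotopyMoves
import Literature.NumberTheory.Transcendental.KZProductIdeal
import Literature.NumberTheory.Transcendental.SemialgebraicDerivativeProofs

/-!
# `ManinStokes` (stmt-KontsevichZagierPeriods-5277): the product compactification of the lower half plane

Support file (prover-owned, `--supports stmt-KontsevichZagierPeriods-5277`; generic, reusable). To write Cauchy's
theorem `∫_ℝ G(u) du = 0` for a holomorphic `G` on the lower half plane as Kontsevich–Zagier moves, the half
plane is compactified by the PRODUCT map `u = x(t) + i y(s)`, `x(t) = t/(1 − t²)` (`(−1,1) → ℝ`),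
`y(s) = −s/(1 − s)` (`[0,1) → (−∞,0]`): the closed rectangle `(−1,1) × [0,1]` is a band both ways, its bottom
edge `s = 0` is the real axis parametrised by `u = x(t)` itself, and the three other edges lie at infinity,
where the primitives of Green's formula vanish by the decay of `G`. This file: elementary properties of `x`, `y`
(written through characterising hypotheses `hx`, `hy`; no definitions), the fibre maps `s ↦ x₀ + i y(s)`,
`t ↦ x(t) + i y₀`, the fibrewise derivatives of `re G`, `im G` along them (chain rule), and the continuity of
the two primitives `A(t,s) = re G(x(t)+iy(s)) x'(t)` (vertical, `0` at `s = 1`) and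
`B(s,t) = −im G(x(t)+iy(s)) y'(s)` (horizontal, `0` at `t = ±1`) on the CLOSED fibres, from the decay of `G`
at infinity in the closed lower half plane.

References: M. Kontsevich, D. Zagier, *Periods* (2001), §1.2 rules (2)–(3). No definitions, no named facts.
-/

noncomputable section

open Set MeasureTheory Filter Topology
open Literature.NumberTheory.Transcendental Literature.ModelTheory.ExponentialFields

namespace Summit.KontsevichZagierPeriods.HeckeMultiplicityOne.ManinStokes

/-! ## The product compactification of the lower half plane: `u = x(t) + i y(s)`

`x(t) = t/(1 − t²)` maps `(−1, 1)` onto `ℝ` and `y(s) = −s/(1 − s)` maps `[0, 1)` onto `(−∞, 0]`;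
`Φ(t, s) = x(t) + i y(s)` maps the half-open rectangle `(−1,1) × [0,1)` onto the closed lower half
plane, the bottom edge `s = 0` onto the real axis with `u = x(t)`, and the three other edges to
infinity. All maps are written through characterising hypotheses (`hx : ∀ t, x t = t / (1 - t ^ 2)`,
`hy : ∀ s, y s = -s / (1 - s)`); no definitions are introduced. -/

section ProductMap

variable {x y : ℝ → ℝ}

/-- `1 − t² > 0` on `(−1, 1)`. [folklore] -/
theorem one_sub_sq_pos {t : ℝ} (ht : t ∈ Ioo (-1 : ℝ) 1) : 0 < 1 - t ^ 2 := by
  nlinarith [ht.1, ht.2]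

/-- The derivative of `x(t) = t/(1 − t²)` on `(−1, 1)`: `(1 + t²)/(1 − t²)²`. [folklore] -/
theorem hasDerivAt_xMap (hx : ∀ t, x t = t / (1 - t ^ 2)) {t : ℝ} (ht : t ∈ Ioo (-1 : ℝ) 1) :
    HasDerivAt x ((1 + t ^ 2) / (1 - t ^ 2) ^ 2) t := by
  have h0 : (1 - t ^ 2) ≠ 0 := (one_sub_sq_pos ht).ne'
  have h2 : HasDerivAt (fun t : ℝ => 1 - t ^ 2) (-(2 * t)) t := by
    simpa using ((hasDerivAt_id t).pow 2).const_sub 1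
  have h1 : HasDerivAt (fun t : ℝ => t / (1 - t ^ 2)) ((1 * (1 - t ^ 2) - t * (-(2 * t))) / (1 - t ^ 2) ^ 2) t :=
    (hasDerivAt_id t).div h2 h0
  have heq : x = fun t : ℝ => t / (1 - t ^ 2) := funext hx
  rw [heq]
  convert h1 using 1
  ring

/-- `x` is strictly increasing on `(−1, 1)`. [folklore] -/
theorem strictMonoOn_xMap (hx : ∀ t, x t = t / (1 - t ^ 2)) : StrictMonoOn x (Ioo (-1 : ℝ) 1) := by
  refine strictMonoOn_of_deriv_pos (convex_Ioo _ _) ?_ ?_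
  · exact fun t ht => (hasDerivAt_xMap hx ht).continuousAt.continuousWithinAt
  · intro t ht
    rw [interior_Ioo] at ht
    rw [(hasDerivAt_xMap hx ht).deriv]
    exact div_pos (by positivity) (pow_pos (one_sub_sq_pos ht) 2)

/-- The explicit inverse of `x`: `t(u) = 2u/(1 + √(1 + 4u²)) ∈ (−1, 1)` with `x(t(u)) = u`. [folklore] -/
theorem exists_xMap_eq (hx : ∀ t, x t = t / (1 - t ^ 2)) (u : ℝ) : ∃ t ∈ Ioo (-1 : ℝ) 1, x t = u := by
  set r := Real.sqrt (1 + 4 * u ^ 2) with hr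
  have hr0 : 0 ≤ r := Real.sqrt_nonneg _
  have hr2 : r ^ 2 = 1 + 4 * u ^ 2 := Real.sq_sqrt (by positivity)
  have hr1 : 1 ≤ r := by nlinarith
  have hden : 0 < 1 + r := by linarith
  refine ⟨2 * u / (1 + r), ⟨?_, ?_⟩, ?_⟩
  · rw [lt_div_iff₀ hden]; nlinarith
  · rw [div_lt_iff₀ hden]; nlinarith
  · rw [hx]
    have h1 : 1 - (2 * u / (1 + r)) ^ 2 = 2 / (1 + r) := by
      field_simp
      nlinarith
    rw [h1]
    field_simp

/-- **`x` maps `(−1, 1)` onto `ℝ`.** [folklore] -/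
theorem image_xMap (hx : ∀ t, x t = t / (1 - t ^ 2)) : x '' Ioo (-1 : ℝ) 1 = univ := by
  refine eq_univ_of_forall fun u => ?_
  obtain ⟨t, ht, htu⟩ := exists_xMap_eq hx u
  exact ⟨t, ht, htu⟩

/-- `x(t) = 0` only at `t = 0`. [folklore] -/
theorem xMap_eq_zero_iff (hx : ∀ t, x t = t / (1 - t ^ 2)) {t : ℝ} (ht : t ∈ Ioo (-1 : ℝ) 1) :
    x t = 0 ↔ t = 0 := by
  rw [hx, div_eq_zero_iff]
  have := (one_sub_sq_pos ht).ne'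
  tauto

/-- `x(t) = 1728` exactly when `1728 (1 − t²) = t`. [folklore] -/
theorem xMap_eq_iff (hx : ∀ t, x t = t / (1 - t ^ 2)) {t : ℝ} (ht : t ∈ Ioo (-1 : ℝ) 1) (c : ℝ) :
    x t = c ↔ c * (1 - t ^ 2) = t := by
  rw [hx, div_eq_iff (one_sub_sq_pos ht).ne', eq_comm]

/-- The derivative of `y(s) = −s/(1 − s)` off `s = 1`: `−1/(1 − s)²`. [folklore] -/
theorem hasDerivAt_yMap (hy : ∀ s, y s = -s / (1 - s)) {s : ℝ} (hs : s ≠ 1) :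
    HasDerivAt y (-1 / (1 - s) ^ 2) s := by
  have h0 : (1 - s) ≠ 0 := sub_ne_zero.mpr (Ne.symm hs)
  have h2 : HasDerivAt (fun s : ℝ => 1 - s) (-1) s := by
    simpa using (hasDerivAt_id s).const_sub 1
  have h1 : HasDerivAt (fun s : ℝ => -s / (1 - s)) ((-1 * (1 - s) - -s * (-1)) / (1 - s) ^ 2) s :=
    (hasDerivAt_id s).neg.div h2 h0
  have heq : y = fun s : ℝ => -s / (1 - s) := funext hy
  rw [heq]
  convert h1 using 1
  ring

/-- `y(0) = 0`. [folklore] -/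
theorem yMap_zero (hy : ∀ s, y s = -s / (1 - s)) : y 0 = 0 := by rw [hy]; simp

/-- `y(s) < 0` for `0 < s < 1`. [folklore] -/
theorem yMap_neg (hy : ∀ s, y s = -s / (1 - s)) {s : ℝ} (hs : s ∈ Ioo (0 : ℝ) 1) : y s < 0 := by
  rw [hy]
  exact div_neg_of_neg_of_pos (by linarith [hs.1]) (by linarith [hs.2])

/-- `y(s) ≤ 0` for `0 ≤ s < 1`. [folklore] -/
theorem yMap_nonpos (hy : ∀ s, y s = -s / (1 - s)) {s : ℝ} (hs : s ∈ Ico (0 : ℝ) 1) : y s ≤ 0 := by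
  rw [hy]
  exact div_nonpos_of_nonpos_of_nonneg (by linarith [hs.1]) (by linarith [hs.2])

/-- `y` is strictly decreasing on `[0, 1)`. [folklore] -/
theorem strictAntiOn_yMap (hy : ∀ s, y s = -s / (1 - s)) : StrictAntiOn y (Ico (0 : ℝ) 1) := by
  intro s hs s' hs' hss'
  rw [hy, hy, div_lt_div_iff₀ (by linarith [hs'.2]) (by linarith [hs.2])]
  nlinarith [hs.1, hs'.2]

/-- **`y` tends to `−∞` at `1⁻`**, quantitatively: `y(s) ≤ −M` once `1 − 1/(M+1) ≤ s < 1` (`M ≥ 0`). [folklore] -/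
theorem yMap_le_neg (hy : ∀ s, y s = -s / (1 - s)) {M : ℝ} (hM : 0 ≤ M) {s : ℝ} (hs1 : s < 1)
    (hs : 1 - 1 / (M + 1) ≤ s) : y s ≤ -M := by
  rw [hy, div_le_iff₀ (by linarith), neg_mul, neg_le_neg_iff]
  have h1 : 1 / (M + 1) * (M + 1) = 1 := by field_simp
  nlinarith [hs, h1, mul_nonneg hM (show (0 : ℝ) ≤ 1 - s by linarith)]

/-- **`|x|` tends to `∞` at `±1`**, quantitatively: `M ≤ |x t|` once `1 − 1/(2(M+1)) ≤ |t| < 1` (`M ≥ 0`). [folklore] -/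
theorem le_abs_xMap (hx : ∀ t, x t = t / (1 - t ^ 2)) {M : ℝ} (hM : 0 ≤ M) {t : ℝ} (ht : t ∈ Ioo (-1 : ℝ) 1)
    (htM : 1 - 1 / (2 * (M + 1)) ≤ |t|) : M ≤ |x t| := by
  have h0 := one_sub_sq_pos ht
  rw [hx, abs_div, abs_of_pos h0, le_div_iff₀ h0]
  have ha1 : |t| < 1 := abs_lt.mpr ⟨ht.1, ht.2⟩
  have ha0 : 0 ≤ |t| := abs_nonneg t
  have ht2 : t ^ 2 = |t| ^ 2 := (sq_abs t).symm
  rw [ht2]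
  have h1 : 1 / (2 * (M + 1)) * (2 * (M + 1)) = 1 := by field_simp
  have h12 : (1 : ℝ) / 2 ≤ |t| := by
    have : 1 / (2 * (M + 1)) ≤ 1 / 2 := by
      rw [div_le_div_iff₀ (by positivity) (by positivity)]; nlinarith
    linarith
  -- `M (1 − a²) ≤ M · 2 (1 − a) ≤ a` for `a = |t| ≥ 1 − 1/(2(M+1))`
  nlinarith [mul_nonneg hM (show (0 : ℝ) ≤ 1 - |t| by linarith), h1, htM]

end ProductMap

/-! ## Green's theorem for `re (G du)` on the lower half plane through the product compactification -/

section HalfPlaneGreen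

variable {x y xd yd : ℝ → ℝ} {G : ℂ → ℂ} {A B g gv : (Fin 2 → ℝ) → ℝ}

/-- Coordinates of `Fin.snoc` on `ℝ¹ → ℝ²`. [folklore] -/
theorem snoc_zero (t : Fin 1 → ℝ) (s : ℝ) : (Fin.snoc t s : Fin 2 → ℝ) 0 = t 0 := by
  rw [show (0 : Fin 2) = Fin.castSucc (0 : Fin 1) from rfl, Fin.snoc_castSucc]

/-- Coordinates of `Fin.snoc` on `ℝ¹ → ℝ²`. [folklore] -/
theorem snoc_one (t : Fin 1 → ℝ) (s : ℝ) : (Fin.snoc t s : Fin 2 → ℝ) 1 = s := by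
  rw [show (1 : Fin 2) = Fin.last 1 from rfl, Fin.snoc_last]

/-- `Fin.init` on `ℝ² → ℝ¹`. [folklore] -/
theorem init_apply_zero (w : Fin 2 → ℝ) : (Fin.init w : Fin 1 → ℝ) 0 = w 0 := rfl

/-- The inner map `s ↦ x₀ + i y(s)` of a vertical fibre has derivative `i y'(s)`. [folklore] -/
theorem hasDerivAt_vertical (hy : ∀ s, y s = -s / (1 - s)) (x₀ : ℝ) {s : ℝ} (hs : s ≠ 1) :
    HasDerivAt (fun s : ℝ => ((x₀ : ℂ) + (y s : ℂ) * Complex.I)) (((-1 / (1 - s) ^ 2 : ℝ) : ℂ) * Complex.I) s := by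
  have h := (hasDerivAt_yMap hy hs).ofReal_comp.mul_const Complex.I
  exact h.const_add _

/-- The inner map `t ↦ x(t) + i y₀` of a horizontal fibre has derivative `x'(t)`. [folklore] -/
theorem hasDerivAt_horizontal (hx : ∀ t, x t = t / (1 - t ^ 2)) (y₀ : ℝ) {t : ℝ} (ht : t ∈ Ioo (-1 : ℝ) 1) :
    HasDerivAt (fun t : ℝ => ((x t : ℂ) + (y₀ : ℂ) * Complex.I)) (((1 + t ^ 2) / (1 - t ^ 2) ^ 2 : ℝ) : ℂ) t := by
  have h := (hasDerivAt_xMap hx ht).ofReal_comp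
  simpa using h.add_const ((y₀ : ℂ) * Complex.I)

/-- **Derivative along a vertical fibre**: `∂ₛ re G(x₀ + i y(s)) · x' = −im G'(…) · y'(s) · x'`. [folklore] -/
theorem hasDerivAt_re_G_vertical (hy : ∀ s, y s = -s / (1 - s)) (x₀ c : ℝ) {s : ℝ} (hs : s ≠ 1)
    (hG : DifferentiableAt ℂ G ((x₀ : ℂ) + (y s : ℂ) * Complex.I)) :
    HasDerivAt (fun s : ℝ => (G ((x₀ : ℂ) + (y s : ℂ) * Complex.I)).re * c)
      (-(deriv G ((x₀ : ℂ) + (y s : ℂ) * Complex.I)).im * (-1 / (1 - s) ^ 2) * c) s := by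
  have h1 := hG.hasDerivAt.comp s (hasDerivAt_vertical hy x₀ hs)
  have h2 := (Complex.reCLM.hasFDerivAt).comp_hasDerivAt s h1
  have h3 : HasDerivAt (fun s : ℝ => (G ((x₀ : ℂ) + (y s : ℂ) * Complex.I)).re * c)
      ((Complex.reCLM (deriv G ((x₀ : ℂ) + (y s : ℂ) * Complex.I) *
        (((-1 / (1 - s) ^ 2 : ℝ) : ℂ) * Complex.I))) * c) s := h2.mul_const c
  refine h3.congr_deriv ?_
  rw [Complex.reCLM_apply, Complex.mul_re, Complex.re_ofReal_mul, Complex.im_ofReal_mul, Complex.I_re,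
    Complex.I_im]
  ring

/-- **Derivative along a horizontal fibre**: `∂ₜ (−im G(x(t) + i y₀)) · c = −im G'(…) · x'(t) · c`. [folklore] -/
theorem hasDerivAt_im_G_horizontal (hx : ∀ t, x t = t / (1 - t ^ 2)) (y₀ c : ℝ) {t : ℝ} (ht : t ∈ Ioo (-1 : ℝ) 1)
    (hG : DifferentiableAt ℂ G ((x t : ℂ) + (y₀ : ℂ) * Complex.I)) :
    HasDerivAt (fun t : ℝ => -(G ((x t : ℂ) + (y₀ : ℂ) * Complex.I)).im * c)
      (-(deriv G ((x t : ℂ) + (y₀ : ℂ) * Complex.I)).im * ((1 + t ^ 2) / (1 - t ^ 2) ^ 2) * c) t := by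
  have h1 := hG.hasDerivAt.comp t (hasDerivAt_horizontal hx y₀ ht)
  have h2 := (Complex.imCLM.hasFDerivAt).comp_hasDerivAt t h1
  have h3 : HasDerivAt (fun t : ℝ => -(G ((x t : ℂ) + (y₀ : ℂ) * Complex.I)).im * c)
      (-(Complex.imCLM (deriv G ((x t : ℂ) + (y₀ : ℂ) * Complex.I) *
        (((1 + t ^ 2) / (1 - t ^ 2) ^ 2 : ℝ) : ℂ))) * c) t := (h2.neg).mul_const c
  refine h3.congr_deriv ?_
  rw [Complex.imCLM_apply, Complex.mul_im, Complex.ofReal_re, Complex.ofReal_im]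
  ring

/-- The point `x(t) + i y(s)` lies in the open lower half plane for `0 < s < 1`. [folklore] -/
theorem phi_im_neg (hy : ∀ s, y s = -s / (1 - s)) (x₀ : ℝ) {s : ℝ} (hs : s ∈ Ioo (0 : ℝ) 1) :
    ((x₀ : ℂ) + (y s : ℂ) * Complex.I).im < 0 := by
  simpa using yMap_neg hy hs

/-- The point `x(t) + i y(s)` lies in the punctured closed lower half plane for `t ∈ (−1,1) ∖ {0, x⁻¹(1728)}`,
`0 ≤ s < 1`. [folklore] -/
theorem phi_mem (hx : ∀ t, x t = t / (1 - t ^ 2)) (hy : ∀ s, y s = -s / (1 - s)) {t s : ℝ}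
    (ht : t ∈ Ioo (-1 : ℝ) 1) (ht0 : t ≠ 0) (ht1 : 1728 * (1 - t ^ 2) ≠ t) (hs : s ∈ Ico (0 : ℝ) 1) :
    ((x t : ℂ) + (y s : ℂ) * Complex.I) ∈ {u : ℂ | u.im ≤ 0 ∧ u ≠ 0 ∧ u ≠ 1728} := by
  have him : ((x t : ℂ) + (y s : ℂ) * Complex.I).im = y s := by simp
  have hre : ((x t : ℂ) + (y s : ℂ) * Complex.I).re = x t := by simp
  refine ⟨by rw [him]; exact yMap_nonpos hy hs, fun h0 => ?_, fun h0 => ?_⟩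
  · have h := congrArg Complex.re h0
    rw [hre, Complex.zero_re, xMap_eq_zero_iff hx ht] at h
    exact ht0 h
  · have h := congrArg Complex.re h0
    rw [hre, show (1728 : ℂ).re = 1728 by norm_num, xMap_eq_iff hx ht] at h
    exact ht1 h

/-- **Decay along a vertical fibre**: `re G(x₀ + i y(s)) · c → 0` as `s → 1⁻`, quantitatively from the
decay of `G` at infinity in the closed lower half plane. [folklore] -/
theorem vertical_small (hy : ∀ s, y s = -s / (1 - s))
    (hGdecay : ∀ ε > 0, ∃ R, ∀ u : ℂ, u.im ≤ 0 → R ≤ ‖u‖ → ‖G u‖ ≤ ε)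
    (x₀ c : ℝ) {ε : ℝ} (hε : 0 < ε) :
    ∃ δ > 0, ∀ s : ℝ, s ∈ Ico (0 : ℝ) 1 → 1 - δ ≤ s → |(G ((x₀ : ℂ) + (y s : ℂ) * Complex.I)).re * c| ≤ ε := by
  obtain ⟨R, hR⟩ := hGdecay (ε / (|c| + 1)) (by positivity)
  set M := max R 0 with hM
  refine ⟨1 / (M + 1), by positivity, fun s hs hsd => ?_⟩
  have hyM : y s ≤ -M := yMap_le_neg hy (le_max_right _ _) hs.2 hsd
  have hnorm : R ≤ ‖(x₀ : ℂ) + (y s : ℂ) * Complex.I‖ := by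
    have h1 : |((x₀ : ℂ) + (y s : ℂ) * Complex.I).im| ≤ ‖(x₀ : ℂ) + (y s : ℂ) * Complex.I‖ :=
      Complex.abs_im_le_norm _
    have h2 : ((x₀ : ℂ) + (y s : ℂ) * Complex.I).im = y s := by simp
    rw [h2] at h1
    have : M ≤ |y s| := by rw [abs_of_nonpos (by linarith [le_max_right R 0])]; linarith
    linarith [le_max_left R 0]
  have hG := hR _ (by simpa using yMap_nonpos hy hs) hnorm
  rw [abs_mul]
  calc |(G ((x₀ : ℂ) + (y s : ℂ) * Complex.I)).re| * |c|
      ≤ ‖G ((x₀ : ℂ) + (y s : ℂ) * Complex.I)‖ * |c| := by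
        gcongr; exact Complex.abs_re_le_norm _
    _ ≤ ε / (|c| + 1) * |c| := by gcongr
    _ ≤ ε := by
        rw [div_mul_eq_mul_div, div_le_iff₀ (by positivity)]
        nlinarith [abs_nonneg c]

/-- **Decay along a horizontal fibre**: `im G(x(t) + i y₀) · c → 0` as `t → ±1`. [folklore] -/
theorem horizontal_small (hx : ∀ t, x t = t / (1 - t ^ 2))
    (hGdecay : ∀ ε > 0, ∃ R, ∀ u : ℂ, u.im ≤ 0 → R ≤ ‖u‖ → ‖G u‖ ≤ ε)
    {y₀ : ℝ} (hy₀ : y₀ ≤ 0) (c : ℝ) {ε : ℝ} (hε : 0 < ε) :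
    ∃ δ > 0, ∀ t : ℝ, t ∈ Ioo (-1 : ℝ) 1 → 1 - δ ≤ |t| → |(G ((x t : ℂ) + (y₀ : ℂ) * Complex.I)).im * c| ≤ ε := by
  obtain ⟨R, hR⟩ := hGdecay (ε / (|c| + 1)) (by positivity)
  set M := max R 0 with hM
  refine ⟨1 / (2 * (M + 1)), by positivity, fun t ht htd => ?_⟩
  have hxM : M ≤ |x t| := le_abs_xMap hx (le_max_right _ _) ht htd
  have hnorm : R ≤ ‖(x t : ℂ) + (y₀ : ℂ) * Complex.I‖ := by
    have h1 : |((x t : ℂ) + (y₀ : ℂ) * Complex.I).re| ≤ ‖(x t : ℂ) + (y₀ : ℂ) * Complex.I‖ :=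
      Complex.abs_re_le_norm _
    have h2 : ((x t : ℂ) + (y₀ : ℂ) * Complex.I).re = x t := by simp
    rw [h2] at h1
    linarith [le_max_left R 0]
  have hG := hR _ (by simpa using hy₀) hnorm
  rw [abs_mul]
  calc |(G ((x t : ℂ) + (y₀ : ℂ) * Complex.I)).im| * |c|
      ≤ ‖G ((x t : ℂ) + (y₀ : ℂ) * Complex.I)‖ * |c| := by
        gcongr; exact Complex.abs_im_le_norm _
    _ ≤ ε / (|c| + 1) * |c| := by gcongr
    _ ≤ ε := by
        rw [div_mul_eq_mul_div, div_le_iff₀ (by positivity)]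
        nlinarith [abs_nonneg c]

/-- **Continuity of the vertical primitive on the closed fibre `[0, 1]`**:
`s ↦ A(t, s) = re G(x(t) + i y(s)) · x'(t)` for `s < 1`, `0` at `s = 1`. [folklore] -/
theorem continuousOn_vertical_primitive (hx : ∀ t, x t = t / (1 - t ^ 2)) (hy : ∀ s, y s = -s / (1 - s))
    (hGc : ContinuousOn G {u : ℂ | u.im ≤ 0 ∧ u ≠ 0 ∧ u ≠ 1728})
    (hGdecay : ∀ ε > 0, ∃ R, ∀ u : ℂ, u.im ≤ 0 → R ≤ ‖u‖ → ‖G u‖ ≤ ε)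
    (hA : ∀ w, A w = if w 1 < 1 then (G ((x (w 0) : ℂ) + (y (w 1) : ℂ) * Complex.I)).re * xd (w 0) else 0)
    (t : Fin 1 → ℝ) (ht : t 0 ∈ Ioo (-1 : ℝ) 1) (ht0 : t 0 ≠ 0) (ht1 : 1728 * (1 - t 0 ^ 2) ≠ t 0) :
    ContinuousOn (fun s : ℝ => A (Fin.snoc t s)) (Icc 0 1) := by
  -- the formula version, continuous on `[0, 1)`
  set f : ℝ → ℝ := fun s => (G ((x (t 0) : ℂ) + (y s : ℂ) * Complex.I)).re * xd (t 0) with hf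
  have hAf : ∀ s, s < 1 → A (Fin.snoc t s) = f s := by
    intro s hs
    rw [hA, snoc_one, snoc_zero, if_pos hs]
  have hA1 : ∀ s, ¬ s < 1 → A (Fin.snoc t s) = 0 := by
    intro s hs
    rw [hA, snoc_one, if_neg hs]
  have hyc : ContinuousOn y (Iio 1) := fun s hs =>
    (hasDerivAt_yMap hy (ne_of_lt hs)).continuousAt.continuousWithinAt
  have hfc : ContinuousOn f (Ico 0 1) := by
    refine ContinuousOn.mul ?_ continuousOn_const
    refine Complex.continuous_re.comp_continuousOn (hGc.comp ?_ fun s hs => phi_mem hx hy ht ht0 ht1 hs)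
    exact (continuousOn_const.add ((Complex.continuous_ofReal.comp_continuousOn
      (hyc.mono fun s (hs : s ∈ Ico (0 : ℝ) 1) => hs.2)).mul continuousOn_const))
  intro s₀ hs₀
  rcases hs₀.2.lt_or_eq with hlt | heq
  · -- interior / left end: `A = f` near `s₀`
    have hfc' : ContinuousWithinAt f (Icc 0 1) s₀ := by
      have := (hfc.mono (show Icc 0 1 ∩ Iio 1 ⊆ Ico 0 1 from fun s hs => ⟨hs.1.1, hs.2⟩))
      have h2 : ContinuousWithinAt f (Icc 0 1 ∩ Iio 1) s₀ := this s₀ ⟨hs₀, hlt⟩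
      exact (continuousWithinAt_inter (Iio_mem_nhds hlt)).mp h2
    refine hfc'.congr_of_eventuallyEq ?_ (hAf s₀ hlt)
    filter_upwards [mem_nhdsWithin_of_mem_nhds (Iio_mem_nhds hlt)] with s hs
    exact hAf s hs
  · -- the end `s₀ = 1`: the values tend to `0 = A(t, 1)`
    subst heq
    rw [ContinuousWithinAt, hA1 1 (lt_irrefl 1), Metric.tendsto_nhdsWithin_nhds]
    intro ε hε
    obtain ⟨δ, hδ, hδε⟩ := vertical_small hy hGdecay (x (t 0)) (xd (t 0)) (half_pos hε)
    refine ⟨δ, hδ, fun s hs hds => ?_⟩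
    rw [Real.dist_eq, sub_zero]
    by_cases hs1 : s < 1
    · rw [hAf s hs1]
      have := hδε s ⟨hs.1, hs1⟩ (by rw [Real.dist_eq, abs_lt] at hds; linarith [hds.1])
      linarith
    · rw [hA1 s hs1, abs_zero]; exact hε

/-- **Continuity of the horizontal primitive on the closed fibre `[−1, 1]`**:
`t ↦ B(s, t) = −im G(x(t) + i y(s)) · y'(s)` for `|t| < 1`, `0` at `t = ±1` (`0 < s < 1`). [folklore] -/
theorem continuousOn_horizontal_primitive (hx : ∀ t, x t = t / (1 - t ^ 2)) (hy : ∀ s, y s = -s / (1 - s))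
    (hGc : ContinuousOn G {u : ℂ | u.im ≤ 0 ∧ u ≠ 0 ∧ u ≠ 1728})
    (hGdecay : ∀ ε > 0, ∃ R, ∀ u : ℂ, u.im ≤ 0 → R ≤ ‖u‖ → ‖G u‖ ≤ ε)
    (hB : ∀ w, B w = if w 1 ∈ Ioo (-1 : ℝ) 1 then -(G ((x (w 1) : ℂ) + (y (w 0) : ℂ) * Complex.I)).im * yd (w 0) else 0)
    (s : Fin 1 → ℝ) (hs : s 0 ∈ Ioo (0 : ℝ) 1) :
    ContinuousOn (fun t : ℝ => B (Fin.snoc s t)) (Icc (-1) 1) := by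
  set f : ℝ → ℝ := fun t => -(G ((x t : ℂ) + (y (s 0) : ℂ) * Complex.I)).im * yd (s 0) with hf
  have hBf : ∀ t, t ∈ Ioo (-1 : ℝ) 1 → B (Fin.snoc s t) = f t := by
    intro t ht
    rw [hB, snoc_one, snoc_zero, if_pos ht]
  have hB0 : ∀ t, t ∉ Ioo (-1 : ℝ) 1 → B (Fin.snoc s t) = 0 := by
    intro t ht
    rw [hB, snoc_one, if_neg ht]
  have hxc : ContinuousOn x (Ioo (-1) 1) := fun t ht =>
    (hasDerivAt_xMap hx ht).continuousAt.continuousWithinAt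
  have hys : y (s 0) < 0 := yMap_neg hy hs
  have hfc : ContinuousOn f (Ioo (-1) 1) := by
    refine ContinuousOn.mul (ContinuousOn.neg ?_) continuousOn_const
    refine Complex.continuous_im.comp_continuousOn (hGc.comp ?_ fun t _ => ?_)
    · exact ((Complex.continuous_ofReal.comp_continuousOn hxc).add continuousOn_const)
    · refine ⟨by simp [hys.le], fun h0 => ?_, fun h0 => ?_⟩
      · have := congrArg Complex.im h0; simp at this; linarith
      · have := congrArg Complex.im h0; simp at this; linarith
  intro t₀ ht₀
  by_cases hint : t₀ ∈ Ioo (-1 : ℝ) 1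
  · have hfc' : ContinuousWithinAt f (Icc (-1) 1) t₀ :=
      (hfc.continuousAt (isOpen_Ioo.mem_nhds hint)).continuousWithinAt
    refine hfc'.congr_of_eventuallyEq ?_ (hBf t₀ hint)
    filter_upwards [mem_nhdsWithin_of_mem_nhds (isOpen_Ioo.mem_nhds hint)] with t ht
    exact hBf t ht
  · -- an endpoint `t₀ = ±1`
    have ht1 : |t₀| = 1 := by
      rcases ht₀.1.eq_or_lt with h | h
      · rw [← h]; norm_num
      rcases ht₀.2.lt_or_eq with h' | h'
      · exact absurd ⟨h, h'⟩ hint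
      · rw [h']; norm_num
    rw [ContinuousWithinAt, hB0 t₀ hint, Metric.tendsto_nhdsWithin_nhds]
    intro ε hε
    obtain ⟨δ, hδ, hδε⟩ := horizontal_small hx hGdecay hys.le (yd (s 0)) (half_pos hε)
    refine ⟨δ, hδ, fun t ht hdt => ?_⟩
    rw [Real.dist_eq, sub_zero]
    by_cases htI : t ∈ Ioo (-1 : ℝ) 1
    · rw [hBf t htI]
      have hclose : 1 - δ ≤ |t| := by
        rw [Real.dist_eq] at hdt
        have := abs_sub_abs_le_abs_sub t₀ t
        rw [abs_sub_comm] at this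
        linarith
      have := hδε t htI hclose
      rw [hf]
      simp only [neg_mul, abs_neg]
      linarith
    · rw [hB0 t htI, abs_zero]; exact hε

end HalfPlaneGreen


end Summit.KontsevichZagierPeriods.HeckeMultiplicityOne.ManinStokes
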